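import Mathlib
import Literature.NumberTheory.EllipticCurves.HeegnerPoints
import Literature.NumberTheory.EllipticCurves.QuadraticTwist
import Literature.NumberTheory.EllipticCurves.QuadraticTwistSelmerPInfty
import Literature.NumberTheory.EllipticCurves.BSDSelmerCMPConverseGoldfeldProofs
import Literature.NumberTheory.EllipticCurves.TwoIsogenySelmerGroup
import Literature.NumberTheory.EllipticCurves.TwoIsogenySelmerGroupSha
import Literature.NumberTheory.EllipticCurves.TwoIsogenyTorsor
import Literature.NumberTheory.EllipticCurves.MordellWeil
import Literature.NumberTheory.EllipticCurves.Selmer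
import Literature.NumberTheory.EllipticCurves.BSDSha
import Literature.NumberTheory.QuadraticForms.HilbertSymbol

/-!
# Transfer lens g25 (seat bsd-idea-18) — `J0S8Sym` decomposed against tree objects (answer to V#24a)

Crux `HeegnerTwistCouplingInSupply` (stmt-BirchSwinnertonDyer-21381), `j = 0` / X12 corner, EC half
`J0S8Sym` («X12 pair ∧ `s_p(ℓ) = −1` ⟹ `selmerCorank₂((36a1)^{(pℓ)}) = 0»; `SketchTransferG24.lean`,
df0babf0dcf2; crux idea `Ideas/j0s8-ct.md`, critic verdict #24a KEEP / pass-with-price P1–P4).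

This file answers price **P1** ("type the named fact `casselsPairing_twoIsogeny_formula` faithfully:
alternating, kernel EQUAL to `S₂`, value `∏_v (f(P_v), η)_v`") by showing that a SMALLER input suffices
and typing it over REAL tree objects (`WeierstrassCurve.sha`, `twoIsogenyTorsorHom` = `Ξ`,
`twoIsogenyCodomain`, `selmerCorank`, `mordellWeilRank`, `Literature.NumberTheory.QuadraticForms.hilbertSymbol`):

* `SharpSecondDescentCorankZero` (H4, tree-internal, no literature): for `V/ℚ` in two-torsion normal form,
  `rank V(ℚ) = 0`, `Ш(V')[φ̂] = 0` and an alternating bi-additive `B` on `Ш(V)` NON-DEGENERATE ON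
  `Ш(V)[φ] = Ш(V) ⊓ range Ξ_V` give `selmerCorank₂(V) = 0`.  Proof route (all in-tree): `Ш(V)[2] = Ш(V)[φ]`
  (`sha_inf_torsionBy_two_eq_sha_inf_range` pattern, from `Ш(V')[φ̂] = 0`); for `x ∈ Ш[4]`, `y ∈ Ш[φ]`:
  `B(2x, y) = B(x, 2y) = 0`, so `2x = 0`; hence `Ш[2^∞] = Ш[2]`, finite (image of the finite `S^{(φ)}`),
  `shaCorank₂ = 0` (`zpCorank_of_finite_eq_zero`), `selmerCorank₂ = rank + shaCorank₂ = 0`.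
  **No statement `ker Θ₁ = S₂` (Fisher Thm 2.1 / [CTPPS]) is needed**: bi-additivity + alternation +
  ONE non-zero value do everything.
* `CasselsFormulaX12` (P1-min, the literature input, a DERIVED specialisation of Cassels, *Second descents
  for elliptic curves*, Crelle 494 (1998) = Fisher arXiv:1509.03234 §3 [corpus:paper:arxiv-1509.03234 p.6],
  not verbatim print): there is an alternating bi-additive `B` on `Ш(E_X12)` whose value
  `B(Ξ[−p], Ξ[η])` is `½ · 𝟙[∏_{v ∈ {∞,2,3,p,ℓ}} (L(P_v), η)_v = −1]` for the explicit tangent-line pushout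
  form `L = z·s² − 3ℓ(z+2x)·t² + y·r` on `C_{−p} : r² = −p s⁴ + 6pℓ s²t² + 3pℓ² t⁴` (`3x² = py² + z²`,
  `gcd(x,y) = 1`, `x > 0`), for EVERY admissible choice of local points (this encodes independence of
  `P_v`; places `v ∤ 6pℓ∞` contribute `+1` because `C_{−p}` and `L` — coprime coefficients — have good
  reduction there, J0S8-CT-PROOF §3).  Hilbert symbols: the tree's `hilbertSymbol F a b ∈ {±1}` over
  `F = ℝ, ℚ_[2], ℚ_[3], ℚ_[p], ℚ_[ℓ]` — the «small Hilbert-symbol API» the critic asked about EXISTS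
  (`Literature/NumberTheory/QuadraticForms/HilbertSymbol.lean`, reciprocity in
  `Automorphic/QuaternionAlgebraHasse.lean: hilbertSymbol_eq_one_of_forall_completions`).
* `ThmALocalX12` (P3, purely local, M): admissible points exist with five-place product
  `= −((y·w − 3(z+2x))/ℓ)` (factors `+1` at `2, 3, p` since `−ℓ ∈ ℚ_v^{×2}`; `−1` at `∞`; `(u/ℓ)` at `ℓ`).
* `RedeiShiftX12` (elementary, replaces the well-definedness of `s_p(ℓ)` used in g24 §3): from a datum with
  `s_p(ℓ) = ((3x₀ + y w)/ℓ) = −1` the conic point `(x, y, z) = (2x₀ − z₀, y, 2z₀ − 3x₀)` (inverse automorph,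
  `z + 2x = x₀`) has `((y w − 3(z+2x))/ℓ) = ((yw − 3x₀)/ℓ) = (−3z₀²/ℓ)/((yw + 3x₀)/ℓ) = (−1)/(−1) = +1`.
* `BridgeX12` (tree-internal, M): `FirstDescentX12 ∧ CTValueX12 ⟹` the three inputs of H4 for `E_X12`
  (`#E'(ℚ)/φE(ℚ) = #{1,−3} = 2`, `#E(ℚ)/φ̂E'(ℚ) = #{1,3} = 2` ⟹ rank `0`; `Ξ'[3] = Ξ'[δ(T)] = 0` ⟹
  `Ш(E')[φ̂] = 0`; `Ш(E)[φ] = {0, Ξ[−p], Ξ[−ℓ], Ξ[pℓ]}` and `B(Ξ[−p],Ξ[−ℓ]) ≠ 0` ⟹ non-degenerate).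
* `EX12_eq_smul`, `selmerCorank_E36_twist` (model glue, PROVED here): `E36^{(pℓ)} = y² = x³ + (pℓ)³`
  is `⟨1, −pℓ, 0, 0⟩⁻¹ • E_{−3pℓ, 3p²ℓ²}`; `selmerCorank` is invariant (`selmerCorank_eq_of_variableChange`).
* `j0s8Sym_of_parts` (kernel-checked): the six named `Prop`s ⟹ `J0S8Sym`.

Nothing here is an item, a stub or a registered skeleton (W-71/W-79: publish-only; the records of 21381 /
19225 are untouched).  `J0S8Sym`, `FirstDescentX12`, `CasselsFormulaX12`, `ThmALocalX12`, `BridgeX12`,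
`SharpSecondDescentCorankZero` are NOT proved here.  **BSD is not proved by any of this.**
-/

set_option linter.dupNamespace false

noncomputable section

namespace Summit.BirchSwinnertonDyer.BirchSwinnertonDyer.Cruxes.HeegnerTwistCouplingInSupply.TransferG25

open Literature.NumberTheory.EllipticCurves WeierstrassCurve
open Literature.NumberTheory.QuadraticForms (hilbertSymbol)
open WeierstrassCurve.Affine (SqUnits sqClass)
open Padic

/-! ### Verbatim copies of the g24 `Prop`s (`SketchTransferG24.lean`, commit df0babf0dcf2). -/

/-- The X12 corner parameters: primes `p ≡ 11 (mod 12)`, `ℓ ≡ 23 (mod 24)` with `(ℓ/p) = −1`. -/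
def IsX12Pair (p ℓ : ℕ) : Prop :=
  p.Prime ∧ ℓ.Prime ∧ p % 12 = 11 ∧ ℓ % 24 = 23 ∧ jacobiSym (ℓ : ℤ) p = -1

/-- `36a1 : y² = x³ + 1`; `E36.quadraticTwist M = ⟨0,0,0,0,M³⟩ = y² = x³ + M³`. -/
def E36 : WeierstrassCurve ℚ := ⟨0, 0, 0, 0, 1⟩

/-- First `2`-isogeny descent for the X12 corner (verbatim g24). -/
def FirstDescentX12 : Prop :=
  ∀ (p ℓ : ℕ), IsX12Pair p ℓ →
    twoIsogenySelmerGroup (6 * ((p : ℤ) * ℓ)) (-3 * ((p : ℤ) * ℓ) ^ 2) =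
        {1, -3, -(p : ℤ), 3 * (p : ℤ), -(ℓ : ℤ), 3 * (ℓ : ℤ), (p : ℤ) * ℓ, -3 * ((p : ℤ) * ℓ)} ∧
    twoIsogenySelmerGroup (-3 * ((p : ℤ) * ℓ)) (3 * ((p : ℤ) * ℓ) ^ 2) = {1, 3}

/-- Admissible data for the symbol `s_p(ℓ)` (verbatim g24). -/
def RedeiData (p ℓ : ℕ) (x y z w : ℤ) : Prop :=
  0 < x ∧ 3 * x ^ 2 = p * y ^ 2 + z ^ 2 ∧ Int.gcd x y = 1 ∧ ¬ (ℓ : ℤ) ∣ z ∧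
    (ℓ : ℤ) ∣ w ^ 2 - 3 * p

/-- `s_p(ℓ) = −1` for some admissible datum (verbatim g24). -/
def RedeiMinus (p ℓ : ℕ) : Prop :=
  ∃ x y z w : ℤ, RedeiData p ℓ x y z w ∧ jacobiSym (3 * x + y * w) ℓ = -1

/-- **(J0-S8) with the symbol hypothesis** (verbatim g24): X12 pair, `s_p(ℓ) = −1` ⟹
`selmerCorank₂((36a1)^{(pℓ)}) = 0`. -/
def J0S8Sym : Prop :=
  ∀ (p ℓ : ℕ), IsX12Pair p ℓ → RedeiMinus p ℓ → (E36.quadraticTwist ((p : ℚ) * ℓ)).selmerCorank 2 = 0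

/-! ### g25: the two-torsion model and the model glue (proved) -/

/-- The two-torsion normal form of `E_{pℓ} : y² = x³ + (pℓ)³` after `x ↦ X − pℓ`:
`E_{a,b} = ⟨0, a, 0, b, 0⟩`, `a = −3pℓ`, `b = 3(pℓ)²`, `T = (0,0)`. -/
def EX12 (p ℓ : ℕ) : WeierstrassCurve ℚ := ⟨0, -3 * ((p : ℚ) * ℓ), 0, 3 * ((p : ℚ) * ℓ) ^ 2, 0⟩

instance isTwoTorsionNF_EX12 (p ℓ : ℕ) : (EX12 p ℓ).IsTwoTorsionNF := ⟨rfl, rfl, rfl⟩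

/-- `E36^{(pℓ)} = ⟨0,0,0,0,(pℓ)³⟩`. -/
theorem E36_quadraticTwist (d : ℚ) : E36.quadraticTwist d = ⟨0, 0, 0, 0, d ^ 3⟩ := by
  simp only [quadraticTwist, E36, b₂, b₄, b₆]
  ext <;> simp

/-- The model glue: `x ↦ X − pℓ` carries `y² = x³ + (pℓ)³` to `E_{−3pℓ, 3p²ℓ²}`. -/
theorem EX12_eq_smul (p ℓ : ℕ) :
    (⟨1, -((p : ℚ) * ℓ), 0, 0⟩ : VariableChange ℚ) • E36.quadraticTwist ((p : ℚ) * ℓ) = EX12 p ℓ := by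
  rw [E36_quadraticTwist, variableChange_def]
  simp only [EX12, inv_one, Units.val_one]
  ext <;> ring

/-- **Model glue (proved).** `selmerCorank_q((36a1)^{(pℓ)}) = selmerCorank_q(E_{−3pℓ,3p²ℓ²})`
(`selmerCorank_eq_of_variableChange`, AEC X.§4). -/
theorem selmerCorank_E36_twist (p ℓ q : ℕ) :
    (E36.quadraticTwist ((p : ℚ) * ℓ)).selmerCorank q = (EX12 p ℓ).selmerCorank q :=
  selmerCorank_eq_of_variableChange q (EX12_eq_smul p ℓ)

/-- `Δ(E_X12) = −432 (pℓ)⁶`. -/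
theorem EX12_Δ (p ℓ : ℕ) : (EX12 p ℓ).Δ = -432 * ((p : ℚ) * ℓ) ^ 6 := by
  rw [Δ_of_isTwoTorsionNF]
  simp only [EX12]
  ring

/-- `E_X12` is an elliptic curve for an X12 pair (indeed for `pℓ ≠ 0`). -/
theorem isElliptic_EX12 {p ℓ : ℕ} (hp : p ≠ 0) (hl : ℓ ≠ 0) : (EX12 p ℓ).IsElliptic := by
  refine ⟨isUnit_iff_ne_zero.mpr ?_⟩
  rw [EX12_Δ]
  have hD : ((p : ℚ) * ℓ) ≠ 0 := by positivity
  exact mul_ne_zero (by norm_num) (pow_ne_zero _ hD)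

/-! ### g25: the local data of the Cassels formula -/

/-- `Ξ_V[d] ∈ H¹(ℚ, E)`: the class of the `φ`-covering attached to the square class of `d`
(tree: `twoIsogenyTorsorHom`). -/
abbrev Xi (V : WeierstrassCurve ℚ) [V.IsTwoTorsionNF] [V.IsElliptic] (d : ℚ) : V.galH1 :=
  V.twoIsogenyTorsorHom (Additive.ofMul (sqClass d))

/-- A primitive point of the conic `3x² = py² + z²` with `x > 0` (`Q₀ = (U,V,r) = (z, x, py)` on
`Γ_{−p} : r² + pU² = 3pV²`). -/
def ConicData (p : ℕ) (x y z : ℤ) : Prop :=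
  0 < x ∧ 3 * x ^ 2 = p * y ^ 2 + z ^ 2 ∧ Int.gcd x y = 1

section Local

variable (F : Type*) [Field F]

/-- The tangent-line pushout form `L(s,t,r) = z·s² − 3ℓ(z + 2x)·t² + y·r` over a field `F`
(J0S8-CT-PROOF §2: `f = L/t²` — equally `L/s²` — is a pushout function on `C_{−p}`, `div f = 2𝔟`, `[𝔟] = T`). -/
def pushL (ℓ : ℕ) (x y z : ℤ) (P : F × F × F) : F :=
  (z : F) * P.1 ^ 2 - 3 * (ℓ : F) * ((z : F) + 2 * (x : F)) * P.2.1 ^ 2 + (y : F) * P.2.2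

/-- `P = (s,t,r) ∈ F³` is an admissible local point: it lies on
`C_{−p} : r² = −p s⁴ + 6pℓ s²t² + 3pℓ² t⁴` (the `φ`-covering for `ξ = −p`, AEC X.4.9 with
`(a', b') = (6pℓ, −3p²ℓ²)`) and `L(P) ≠ 0` (so `P ≠ 0`, and `P` avoids the zeros and poles of `L/t²`, `L/s²`). -/
def AdmissiblePt (p ℓ : ℕ) (x y z : ℤ) (P : F × F × F) : Prop :=
  P.2.2 ^ 2 = -(p : F) * P.1 ^ 4 + 6 * (p : F) * (ℓ : F) * P.1 ^ 2 * P.2.1 ^ 2 +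
      3 * (p : F) * (ℓ : F) ^ 2 * P.2.1 ^ 4 ∧
    pushL F ℓ x y z P ≠ 0

/-- The local Cassels–Tate term `(L(P), η)_F ∈ {±1}` (tree Hilbert symbol). -/
def locSym (ℓ : ℕ) (x y z : ℤ) (η : ℚ) (P : F × F × F) : ℤ :=
  hilbertSymbol F (pushL F ℓ x y z P) (η : F)

end Local

/-- The five-place product `∏_{v ∈ {∞, 2, 3, p, ℓ}} (L(P_v), η)_v`. -/
def localProduct (p ℓ : ℕ) [Fact p.Prime] [Fact ℓ.Prime] (x y z : ℤ) (η : ℚ)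
    (Pinf : ℝ × ℝ × ℝ) (P₂ : ℚ_[2] × ℚ_[2] × ℚ_[2]) (P₃ : ℚ_[3] × ℚ_[3] × ℚ_[3])
    (Pp : ℚ_[p] × ℚ_[p] × ℚ_[p]) (Pl : ℚ_[ℓ] × ℚ_[ℓ] × ℚ_[ℓ]) : ℤ :=
  locSym ℝ ℓ x y z η Pinf * locSym ℚ_[2] ℓ x y z η P₂ * locSym ℚ_[3] ℓ x y z η P₃ *
    locSym ℚ_[p] ℓ x y z η Pp * locSym ℚ_[ℓ] ℓ x y z η Pl

/-- The value `½ ∈ ℚ/ℤ`. -/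
def half : AddCircle (1 : ℚ) := (((1 : ℚ) / 2 : ℚ) : AddCircle (1 : ℚ))

theorem half_ne_zero : half ≠ 0 := by
  rw [half, Ne, AddCircle.coe_eq_zero_iff]
  rintro ⟨n, hn⟩
  rw [zsmul_eq_mul, mul_one] at hn
  have h2 : (2 * n : ℚ) = 1 := by rw [hn]; norm_num
  have h2' : (2 * n : ℤ) = 1 := by exact_mod_cast h2
  omega

/-! ### g25: the named `Prop`s -/

/-- **P1-min — Cassels' formula for `Θ₁(−p, ·)` in the X12 corner** (DERIVED specialisation of
Cassels 1998 / Fisher arXiv:1509.03234 §3, `p = 2`, `m = 1`; roles: Fisher's `(E, φ, E')` = our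
`(E', φ̂, E)`, his `ψ`-covering `C` of `F` = our `φ`-covering `C_{−p}` of `E'`, his `T` = our `T = (0,0) ∈ E(ℚ)[φ]`):
for an X12 pair there is an alternating bi-additive pairing `B` on `Ш(E_X12/ℚ)` (the Cassels–Tate pairing,
tree fact `WeierstrassCurve.exists_casselsTate_pairing`) such that for every conic datum `(x,y,z)`, every
`η ∈ ℚ^×` with `Ξ[η] ∈ Ш`, and EVERY admissible family of local points at `∞, 2, 3, p, ℓ`:
`B(Ξ[−p], Ξ[η]) = ½` if `∏_v (L(P_v), η)_v = −1` and `= 0` otherwise.  (Independence of the `P_v` and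
vanishing at `v ∤ 6pℓ∞` are built in; both rest on `im δ_v = (im δ'_v)^⊥` and good reduction of
`(C_{−p}, L)` — `L` has coprime coefficients since `gcd(x,y) = 1`.)  Numerically: `Θ₁(−p,−ℓ)` from this
formula agrees with `16 ∣ h(−3pℓ)` in 279/279 pairs and with Fisher's `f(l,m)` code in 3343/3343 instances (g24).
What a typer should type VERBATIM instead (τ4, L): the general number-field statement with an arbitrary
pushout function and all places; this `Prop` is its X12 shadow and the only thing `J0S8Sym` consumes. -/
def CasselsFormulaX12 : Prop :=
  ∀ (p ℓ : ℕ) [Fact p.Prime] [Fact ℓ.Prime], IsX12Pair p ℓ → ∀ [(EX12 p ℓ).IsElliptic],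
    ∃ B : (EX12 p ℓ).sha →+ (EX12 p ℓ).sha →+ AddCircle (1 : ℚ),
      (∀ a, B a a = 0) ∧
      ∀ (x y z : ℤ), ConicData p x y z → ∀ (η : ℚ), η ≠ 0 →
      ∀ (h₁ : Xi (EX12 p ℓ) (-(p : ℚ)) ∈ (EX12 p ℓ).sha) (h₂ : Xi (EX12 p ℓ) η ∈ (EX12 p ℓ).sha)
        (Pinf : ℝ × ℝ × ℝ) (P₂ : ℚ_[2] × ℚ_[2] × ℚ_[2]) (P₃ : ℚ_[3] × ℚ_[3] × ℚ_[3])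
        (Pp : ℚ_[p] × ℚ_[p] × ℚ_[p]) (Pl : ℚ_[ℓ] × ℚ_[ℓ] × ℚ_[ℓ]),
        AdmissiblePt ℝ p ℓ x y z Pinf → AdmissiblePt ℚ_[2] p ℓ x y z P₂ → AdmissiblePt ℚ_[3] p ℓ x y z P₃ →
        AdmissiblePt ℚ_[p] p ℓ x y z Pp → AdmissiblePt ℚ_[ℓ] p ℓ x y z Pl →
          B ⟨_, h₁⟩ ⟨_, h₂⟩ = if localProduct p ℓ x y z η Pinf P₂ P₃ Pp Pl = -1 then half else 0

/-- **P3 — Theorem A, local half** (J0S8-CT-PROOF §3, purely local, M): for an X12 pair, a conic datum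
and a root `w` of `w² ≡ 3p (mod ℓ)` with `ℓ ∤ u₀ := y·w − 3(z + 2x)`, there are admissible local points
with `∏_{v ∈ {∞,2,3,p,ℓ}} (L(P_v), −ℓ)_v = −(u₀/ℓ)`: at `2, 3, p` the factor is `+1` for ANY point
(`−ℓ ≡ 1 (8)`, `−ℓ ≡ 1 (3)`, `(−ℓ/p) = 1` make `−ℓ` a local square); at `∞`, `P_∞ = (0, 1, ℓ√3p)` gives
`L < 0` and `(−,−)_∞ = −1`; at `ℓ`, `P_ℓ = (0, 1, ℓ·w̃)`, `w̃² = 3p`, `w̃ ≡ w`, gives `L = ℓ·u`, `u ≡ u₀`,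
`(ℓu, −ℓ)_ℓ = (u/ℓ)`.  Existence of admissible points at `2, 3, p`: `C_{−p}` is locally soluble there
(`FirstDescentX12`, §1) and `L` vanishes at two geometric points only. -/
def ThmALocalX12 : Prop :=
  ∀ (p ℓ : ℕ) [Fact p.Prime] [Fact ℓ.Prime] (x y z w : ℤ), IsX12Pair p ℓ → ConicData p x y z →
    (ℓ : ℤ) ∣ w ^ 2 - 3 * p → jacobiSym (y * w - 3 * (z + 2 * x)) ℓ ≠ 0 →
    ∃ (Pinf : ℝ × ℝ × ℝ) (P₂ : ℚ_[2] × ℚ_[2] × ℚ_[2]) (P₃ : ℚ_[3] × ℚ_[3] × ℚ_[3])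
      (Pp : ℚ_[p] × ℚ_[p] × ℚ_[p]) (Pl : ℚ_[ℓ] × ℚ_[ℓ] × ℚ_[ℓ]),
      AdmissiblePt ℝ p ℓ x y z Pinf ∧ AdmissiblePt ℚ_[2] p ℓ x y z P₂ ∧ AdmissiblePt ℚ_[3] p ℓ x y z P₃ ∧
      AdmissiblePt ℚ_[p] p ℓ x y z Pp ∧ AdmissiblePt ℚ_[ℓ] p ℓ x y z Pl ∧
        localProduct p ℓ x y z (-(ℓ : ℚ)) Pinf P₂ P₃ Pp Pl = - jacobiSym (y * w - 3 * (z + 2 * x)) ℓ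

/-- **The Rédei shift** (elementary; replaces the well-definedness of `s_p(ℓ)` invoked in g24 §3):
if `s_p(ℓ) = ((3x₀ + y w)/ℓ) = −1` for an admissible datum `(x₀, y, z₀, w)`, then the conic datum
`(x, y, z) := (2x₀ − z₀, y, 2z₀ − 3x₀)` (inverse automorph of `3x² − z²`; `z + 2x = x₀`, `x > 0`,
`gcd(x, y) = 1`) has `((y w − 3(z+2x))/ℓ) = ((y w − 3x₀)/ℓ) = +1`, because
`(yw − 3x₀)(yw + 3x₀) ≡ 3py² − 9x₀² = −3z₀² (mod ℓ)`, `ℓ ∤ z₀`, `(−3/ℓ) = −1` (`ℓ ≡ 2 (3)`). -/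
def RedeiShiftX12 : Prop :=
  ∀ (p ℓ : ℕ), IsX12Pair p ℓ → RedeiMinus p ℓ →
    ∃ x y z w : ℤ, ConicData p x y z ∧ (ℓ : ℤ) ∣ w ^ 2 - 3 * p ∧
      jacobiSym (y * w - 3 * (z + 2 * x)) ℓ = 1

/-- `(−3/ℓ) = −1` for a prime `ℓ ≡ 23 (mod 24)` (indeed for `ℓ ≡ 11 (mod 12)`). -/
theorem jacobiSym_neg_three {ℓ : ℕ} (hℓ : ℓ.Prime) (h24 : ℓ % 24 = 23) : jacobiSym (-3) ℓ = -1 := by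
  have hℓ4 : ℓ % 4 = 3 := by omega
  have hℓ3 : (ℓ : ℤ) % 3 = 2 := by omega
  have h1 : jacobiSym (-1) ℓ = -1 := by
    rw [jacobiSym.at_neg_one (hℓ.odd_of_ne_two (by omega))]
    exact ZMod.χ₄_nat_three_mod_four hℓ4
  have h3 : jacobiSym 3 ℓ = 1 := by
    have hrec := jacobiSym.quadratic_reciprocity_three_mod_four (a := 3) (b := ℓ) (by norm_num) hℓ4
    rw [jacobiSym.mod_left (ℓ : ℤ) 3] at hrec
    push_cast at hrec
    rw [hℓ3] at hrec
    rw [hrec]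
    norm_num
  rw [show (-3 : ℤ) = -1 * 3 by norm_num, jacobiSym.mul_left, h1, h3]
  norm_num

/-- **The Rédei shift holds** (elementary, kernel-checked): see `RedeiShiftX12`. -/
theorem redeiShiftX12_holds : RedeiShiftX12 := by
  intro p ℓ hX hRM
  obtain ⟨x₀, y, z₀, w, ⟨hx0, hrel, hg, hnz, hw⟩, hs⟩ := hRM
  obtain ⟨hp, hℓ, -, hℓ24, -⟩ := hX
  refine ⟨2 * x₀ - z₀, y, 2 * z₀ - 3 * x₀, w, ⟨?_, ?_, ?_⟩, hw, ?_⟩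
  · -- `0 < 2x₀ − z₀`: `z₀² = 3x₀² − py² < 4x₀²`
    by_contra h
    have h1 : 2 * x₀ ≤ z₀ := by linarith
    have h2 : (2 * x₀) * (2 * x₀) ≤ z₀ * z₀ := mul_le_mul h1 h1 (by linarith) (by linarith)
    have hpy : 0 ≤ (p : ℤ) * y ^ 2 := by positivity
    nlinarith [h2, hrel, hpy, hx0]
  · -- the conic relation is preserved by the inverse automorph
    linear_combination hrel
  · -- `gcd(2x₀ − z₀, y) = 1`: `x₀² = (2x₀ − z₀)(2x₀ + z₀) − p·y·y`
    have hcop : IsCoprime x₀ y := Int.isCoprime_iff_gcd_eq_one.mpr hg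
    obtain ⟨a, b, hab⟩ := (hcop.pow_left : IsCoprime (x₀ ^ 2) y)
    exact Int.isCoprime_iff_gcd_eq_one.mp
      ⟨a * (2 * x₀ + z₀), b - a * p * y, by linear_combination hab + a * hrel⟩
  · -- the symbol: `(yw − 3x₀)(yw + 3x₀) ≡ −3 z₀² (mod ℓ)`, `(−3/ℓ) = −1`, `ℓ ∤ z₀`, `((3x₀ + yw)/ℓ) = −1`
    have e1 : y * w - 3 * (2 * z₀ - 3 * x₀ + 2 * (2 * x₀ - z₀)) = y * w - 3 * x₀ := by ring
    rw [e1]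
    have hm3 : jacobiSym (-3) ℓ = -1 := jacobiSym_neg_three hℓ hℓ24
    have hz : jacobiSym (z₀ ^ 2) ℓ = 1 := by
      apply jacobiSym.sq_one'
      have hprime : Prime (ℓ : ℤ) := Nat.prime_iff_prime_int.mp hℓ
      exact Int.isCoprime_iff_gcd_eq_one.mp ((Prime.coprime_iff_not_dvd hprime).mpr hnz).symm
    have hprod : jacobiSym ((y * w - 3 * x₀) * (y * w + 3 * x₀)) ℓ = jacobiSym (-3 * z₀ ^ 2) ℓ := by
      rw [jacobiSym.mod_left _ ℓ, jacobiSym.mod_left (-3 * z₀ ^ 2) ℓ]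
      congr 1
      obtain ⟨k, hk⟩ := hw
      have e2 : (y * w - 3 * x₀) * (y * w + 3 * x₀) = -3 * z₀ ^ 2 + (ℓ : ℤ) * (y ^ 2 * k) := by
        linear_combination y ^ 2 * hk - 3 * hrel
      rw [e2, Int.add_mul_emod_self_left]
    rw [jacobiSym.mul_left, jacobiSym.mul_left, hm3, hz] at hprod
    have hs' : jacobiSym (y * w + 3 * x₀) ℓ = -1 := by rw [add_comm]; exact hs
    rw [hs'] at hprod
    linarith

/-- **The one non-zero value.**  For an X12 pair with `s_p(ℓ) = −1`: an alternating bi-additive `B` on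
`Ш(E_X12)` with `B(Ξ[−p], Ξ[−ℓ]) ≠ 0`. -/
def CTValueX12 : Prop :=
  ∀ (p ℓ : ℕ), IsX12Pair p ℓ → RedeiMinus p ℓ → ∀ [(EX12 p ℓ).IsElliptic],
    ∃ B : (EX12 p ℓ).sha →+ (EX12 p ℓ).sha →+ AddCircle (1 : ℚ), (∀ a, B a a = 0) ∧
      ∀ (h₁ : Xi (EX12 p ℓ) (-(p : ℚ)) ∈ (EX12 p ℓ).sha) (h₂ : Xi (EX12 p ℓ) (-(ℓ : ℚ)) ∈ (EX12 p ℓ).sha),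
        B ⟨_, h₁⟩ ⟨_, h₂⟩ ≠ 0

/-- **(H4) Sharp second descent ⟹ corank zero** (tree-internal prover target, M−; no literature input).
For `V/ℚ` in two-torsion normal form: `rank V(ℚ) = 0`, `Ш(V')[φ̂] := Ш(V') ⊓ range Ξ_{V'} = 0`, and an
alternating bi-additive `B` on `Ш(V)` non-degenerate on `Ш(V)[φ] := Ш(V) ⊓ range Ξ_V` ⟹ `selmerCorank₂(V) = 0`.
Route: `Ш(V)[2] = Ш(V)[φ]` (`sha_inf_torsionBy_two_eq_sha_inf_range`, whose hypothesis is the second one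
here verbatim); `x ∈ Ш[4]`, `y ∈ Ш[φ] ⊆ Ш[2]` ⟹
`B(2x,y) = B(x,2y) = 0` ⟹ `2x = 0`; so `Ш[2^∞] = Ш[2]`, finite (`≤ #S^{(φ)}` classes,
`two_pow_twoIsogenySelmerRank'_eq_natCard_mul`); `shaCorank₂ = 0` (`zpCorank_of_finite_eq_zero`);
`selmerCorank₂ = rank + shaCorank₂` (`selmerCorank_eq_holds`). -/
def SharpSecondDescentCorankZero : Prop :=
  ∀ (V : WeierstrassCurve ℚ) [V.IsTwoTorsionNF] [V.IsElliptic],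
    V.mordellWeilRank = 0 →
    V.twoIsogenyCodomain.sha ⊓ (V.twoIsogenyCodomain).twoIsogenyTorsorHom.range = ⊥ →
    (∃ B : V.sha →+ V.sha →+ AddCircle (1 : ℚ), (∀ a, B a a = 0) ∧
      ∀ a : V.sha, (a : V.galH1) ∈ V.twoIsogenyTorsorHom.range →
        (∀ b : V.sha, (b : V.galH1) ∈ V.twoIsogenyTorsorHom.range → B a b = 0) → a = 0) →
    V.selmerCorank 2 = 0

/-- The three inputs of (H4) for `E_X12`, under X12 ∧ `s_p(ℓ) = −1`. -/
def SharpInputX12 : Prop :=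
  ∀ (p ℓ : ℕ), IsX12Pair p ℓ → RedeiMinus p ℓ → ∀ [(EX12 p ℓ).IsElliptic],
    (EX12 p ℓ).mordellWeilRank = 0 ∧
    (EX12 p ℓ).twoIsogenyCodomain.sha ⊓ ((EX12 p ℓ).twoIsogenyCodomain).twoIsogenyTorsorHom.range = ⊥ ∧
    ∃ B : (EX12 p ℓ).sha →+ (EX12 p ℓ).sha →+ AddCircle (1 : ℚ), (∀ a, B a a = 0) ∧
      ∀ a : (EX12 p ℓ).sha, (a : (EX12 p ℓ).galH1) ∈ (EX12 p ℓ).twoIsogenyTorsorHom.range →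
        (∀ b : (EX12 p ℓ).sha, (b : (EX12 p ℓ).galH1) ∈ (EX12 p ℓ).twoIsogenyTorsorHom.range →
          B a b = 0) → a = 0

/-- **Bridge** (tree-internal prover target, M): first descent + the one non-zero value ⟹ the inputs of
(H4).  Rank: `δ(E'(ℚ)) = ker Ξ ∩ S^{(φ)} = {1, −3}` (`Ξ[−p], Ξ[−ℓ], Ξ[pℓ] ≠ 0` by `B ≠ 0` and
bi-additivity; `Ξ[−3] = Ξ[δ T'] = 0`), `δ'(E(ℚ)) = {1, 3} = S^{(φ̂)}`, so `2^{rank} = 2·2/4`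
(`TwoIsogenySelmerGroupRankProofs`).  `Ш(E')[φ̂] = 0`: its classes are `Ξ'[d]`, `d ∈ S^{(φ̂)} = {1,3}`,
`Ξ'[3] = 0` (`twoIsogenyTorsorHom_sqClass_mem_sha_iff` with the `u = 2` rescaling
`E'' = ⟨0,−12pℓ,0,48p²ℓ²,0⟩ ≅ E_X12`).  Non-degeneracy on `Ш(E)[φ] = {0, Ξ[−p], Ξ[−ℓ], Ξ[pℓ]}`: pair
each non-zero class with `Ξ[−ℓ]` or `Ξ[−p]`. -/
def BridgeX12 : Prop := FirstDescentX12 → CTValueX12 → SharpInputX12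

/-! ### g25: kernel-checked glue -/

/-- `CasselsFormulaX12 ∧ ThmALocalX12 ∧ RedeiShiftX12 ⟹ CTValueX12`. -/
theorem ctValueX12_of (hF : CasselsFormulaX12) (hA : ThmALocalX12) (hR : RedeiShiftX12) :
    CTValueX12 := by
  intro p ℓ hX hRM inst
  haveI : Fact p.Prime := ⟨hX.1⟩
  haveI : Fact ℓ.Prime := ⟨hX.2.1⟩
  obtain ⟨B, hBalt, hBval⟩ := hF p ℓ hX
  refine ⟨B, hBalt, ?_⟩
  intro h₁ h₂
  obtain ⟨x, y, z, w, hC, hw, hj⟩ := hR p ℓ hX hRM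
  obtain ⟨Pinf, P₂, P₃, Pp, Pl, hAinf, hA2, hA3, hAp, hAl, hprod⟩ :=
    hA p ℓ x y z w hX hC hw (by rw [hj]; exact one_ne_zero)
  have hℓ0 : (-(ℓ : ℚ)) ≠ 0 := by
    have : (ℓ : ℚ) ≠ 0 := by exact_mod_cast hX.2.1.ne_zero
    exact neg_ne_zero.mpr this
  have hval := hBval x y z hC (-(ℓ : ℚ)) hℓ0 h₁ h₂ Pinf P₂ P₃ Pp Pl hAinf hA2 hA3 hAp hAl
  rw [hprod, hj] at hval
  rw [hval]
  simp only [if_true]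
  exact half_ne_zero

/-- **Decomposition of `J0S8Sym`** (kernel-checked): model glue and the Rédei shift (both proved here) +
(H4) + bridge + first descent + P1-min + P3 ⟹ `J0S8Sym`.  Five named inputs remain:
`SharpSecondDescentCorankZero` (tree-internal, M−), `BridgeX12` (tree-internal, M), `FirstDescentX12`
(AEC X.4.10 template, M/L), `CasselsFormulaX12` (literature, P1-min), `ThmALocalX12` (local, M). -/
theorem j0s8Sym_of_parts (hH4 : SharpSecondDescentCorankZero) (hBr : BridgeX12) (hFD : FirstDescentX12)
    (hF : CasselsFormulaX12) (hA : ThmALocalX12) : J0S8Sym := by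
  intro p ℓ hX hRM
  haveI : (EX12 p ℓ).IsElliptic := isElliptic_EX12 hX.1.ne_zero hX.2.1.ne_zero
  rw [selmerCorank_E36_twist]
  obtain ⟨hr, hsha', hB⟩ := hBr hFD (ctValueX12_of hF hA redeiShiftX12_holds) p ℓ hX hRM
  exact hH4 (EX12 p ℓ) hr hsha' hB

/-! ### Sanity instances -/

/-- `p = 11, ℓ = 167`: datum `(x₀,y,z₀,w) = (2,1,1,37)` has `s = (43/167) = −1`; the shifted conic datum
`(3, 1, −4)` has `(37 − 3·2)/167 = (31/167) = +1` (so `Θ₁(−11,−167) = −1`, matching `16 ∤ h(−5511) = 56`). -/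
theorem redeiShift_11_167 :
    ConicData 11 3 1 (-4) ∧ (167 : ℤ) ∣ (37 : ℤ) ^ 2 - 3 * 11 ∧
      jacobiSym (1 * 37 - 3 * (-4 + 2 * 3)) 167 = 1 := by
  refine ⟨⟨by norm_num, by norm_num, by decide⟩, by norm_num, ?_⟩
  norm_num [jacobiSym.mod_left]

end Summit.BirchSwinnertonDyer.BirchSwinnertonDyer.Cruxes.HeegnerTwistCouplingInSupply.TransferG25

end
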